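import Literature.NumberTheory.LFunctions.RodgersTaoHamiltonian
import Mathlib.MeasureTheory.Integral.IntervalIntegral.AbsolutelyContinuousFun
import HarnessLib

/-!
# Rodgers–Tao 2020, Corollary 25 (= arXiv v4 Cor. 7.10): `H̃_T(t) = O(δ T log³₊ T)` — CONTENT TWIN

RH-FREE CONTENT (0 defs / 0 named facts). This module proves, without any use of `Λ ≥ 0`, the
implication printed as the proof of **Corollary 25** of Rodgers–Tao, *The de Bruijn–Newman constant
is non-negative*, Forum Math. Pi 8 (2020) e6, p. 56 (= arXiv:1801.05914v4 Cor. 7.10, v5 TeX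
l. 1413–1431):

> «**Corollary 25.** One has `H̃_T(t) = O(δ T log³₊ T)` for `Λ/4 ≤ t ≤ 0`.
> *Proof.* We may take `T` to be large. From Proposition 22 and Lemma 24, we see that for any natural
> number `m`, and for almost every time `t` for which one has `H̃_T(t) ≥ δ m T log³ T`, one has
> `∂ₜ H̃_T(t) ≤ −c δ 2^{2m} T log³ T` for some absolute constant `c > 0`. In particular, if `m` is larger
> than some large absolute constant `m₀`, and `Λ/2 ≤ t ≤ Λ/4` is such that
> `δ m T log³ T ≤ H̃_T(t) ≤ δ (m+1) T log³ T` (dem), then it is not possible (for `m₀` large enough) to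
> have `H̃_T(t') ≥ δ m T log³ T` for all `t ≤ t' ≤ t + c⁻¹ 2^{−2m}`, as this would violate the fundamental
> theorem of calculus for absolutely continuous functions. Thus, by the intermediate value theorem,
> there exists `t ≤ t' ≤ t + c⁻¹ 2^{−2m}` such that `δ (m−1) T log³ T ≤ H̃_T(t') ≤ δ m T log³ T`, and on
> iterating this we conclude (for `m₀` large enough) that there exists `t ≤ t'' ≤ t + 2 c⁻¹ 2^{−2m₀}`
> such that `H̃_T(t'') ≤ δ m₀ T log³ T` (ham). We run this argument with `t` set equal to `Λ/2`, and `m`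
> the unique integer obeying (dem), to conclude (for `m₀` large enough) that there exists
> `Λ/2 ≤ t'' ≤ Λ/4` obeying (ham). […] On the other hand, from Proposition 22 we have
> `∂ₜ H̃_T(t) ≤ O(δ T log³ T)` for almost every `t'' ≤ t ≤ 0`, if `δ` decays sufficiently slowly. The
> claim now follows from the fundamental theorem of calculus (absorbing `m₀` into the implied
> constants), recalling that `H̃_T` is non-negative.»

## What is proved, and how it maps onto the printed proof

* `RodgersTaoTruncHamiltonianBound.sub_le_mul_of_ae_deriv_le` — the fundamental theorem of calculus
  for absolutely continuous functions (Mathlib's `AbsolutelyContinuousOnInterval.integral_deriv_eq_sub`)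
  in slope form: `deriv f ≤ L` a.e. on `[u, v]` gives `f v − f u ≤ L (v − u)`.
* `RodgersTaoTruncHamiltonianBound.descent_step` — one level of the printed iteration: if
  `f(u) ≤ (m+1) D` and `deriv f ≤ (1 − ρ 4^m) D` a.e. where `f ≥ m D`, then `f ≤ m D` somewhere in
  `[u, u + 2/(ρ 4^m)]` (the printed «not possible … by the intermediate value theorem» step; we use the
  contrapositive of the slope bound directly, so no intermediate value theorem is needed).
* `RodgersTaoTruncHamiltonianBound.descent_bound` — the iteration «on iterating this we conclude …»
  with the geometric time budget `Σ_{m ≥ m₁} 2/(ρ 4^m) = 8/(3 ρ 4^{m₁})` (finite induction on the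
  level), followed by the final slope bound `deriv f ≤ D`: an ABSTRACT statement about a real function
  absolutely continuous on `[a, b]`, giving `f ≤ K D` on `[e, b]` for any `a < e ≤ b`, with `K`
  depending on `ρ, a, b, e` only (the printed «absorbing `m₀` into the implied constants»; `|Λ|`
  enters through `e − a = |Λ|/4`).
* `RodgersTaoTruncHamiltonianBound.exists_rate` — the printed «if `δ` decays sufficiently slowly»:
  from inputs of the form `∀ ε > 0, ∃ T₁, ∀ T ≥ T₁, P ε T` an explicit positive threshold rate
  `δ₁(T) → 0` with `P (δ₁ T) T` for all large `T` (diagonal extraction, `Nat.findGreatest`).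
* `rodgers_tao_truncHamiltonian_bound_of` — the SCHEMA at a fixed time `t₀ < 0` with `H_{t₀}`
  real-rooted: the inner shapes (verbatim, as typed in `RodgersTaoHamiltonian`) of Lemma 19
  (`rodgers_tao_truncHamiltonian_expansion`), Proposition 22 (`rodgers_tao_truncHamiltonian_deriv`)
  and Lemma 24 (`rodgers_tao_truncEnergy_lower_bound`) imply the inner shape of Corollary 25
  (`rodgers_tao_truncHamiltonian_bound`) on `[t₀/4, 0]`. Lemma 19 is an input because the printed
  «recalling that `H̃_T` is non-negative» refers to the main term `Σ_{j ∼_T k} ψ_T(j)ψ_T(k) H̃_{jk}(t) ≥ 0`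
  of Lemma 19 (the summands of (69) itself are not sign-definite): it supplies the LOWER bound
  `H̃_T(t) ≥ −o(T log³ T)`.
* `rodgers_tao_truncHamiltonian_bound_of_facts` — the AS-PRINTED reduction
  `rodgers_tao_truncHamiltonian_expansion → rodgers_tao_truncHamiltonian_deriv →
  rodgers_tao_truncEnergy_lower_bound → rodgers_tao_truncHamiltonian_bound`.

Divergences from the printed text (all on the safe side): the constant `c⁻¹ 2^{−2m}` of the printed
step is `2/(3c · 4^m)` here (we keep `3 Ẽ_T` of the `4 Ẽ_T` in (76) after absorbing the
`o(Ẽ_T(t))` error, instead of the unspecified absolute `c`); `m₀` is the explicit `m₁` of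
`descent_bound`; the threshold rate of Corollary 25 is `max(δ₀, δ₁)` with `δ₀` the threshold rate of
Lemma 24 and `δ₁` the rate extracted from Lemma 19 and Proposition 22.

LABEL: RH-FREE; bears_on N-C/N-P (COLUMN 3, de Bruijn–Newman side). WHAT THIS IS NOT: not a proof
of Proposition 22, Lemma 24 or Lemma 19 (they are hypotheses, in their tree shapes); nothing here
bears on the truth of RH.

## References
* [RodgersTaoFMP2020] B. Rodgers, T. Tao, *The de Bruijn–Newman constant is non-negative*, Forum
  Math. Pi 8 (2020), e6 — Cor. 25 p. 56, Prop. 22 p. 48 (76), Lemma 24 p. 54, Lemma 19 p. 44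
  (= arXiv:1801.05914v4 Cor. 7.10, Prop. 7.7, Lemma 7.9, Lemma 7.4).
-/

noncomputable section

open Real Set Filter Topology MeasureTheory

namespace Literature.NumberTheory.LFunctions

namespace RodgersTaoTruncHamiltonianBound

/-! ## The fundamental theorem of calculus in slope form -/

/-- FTC for absolutely continuous functions, slope form: if `f` is absolutely continuous on `[a, b]`
and `deriv f ≤ L` almost everywhere on `[u, v] ⊆ [a, b]`, then `f v − f u ≤ L (v − u)` («the
fundamental theorem of calculus for absolutely continuous functions»).
[cite: RodgersTaoFMP2020, Cor. 25 p. 56 (proof)] -/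
theorem sub_le_mul_of_ae_deriv_le {f : ℝ → ℝ} {a b u v L : ℝ}
    (hf : AbsolutelyContinuousOnInterval f a b) (hau : a ≤ u) (huv : u ≤ v) (hvb : v ≤ b)
    (h : ∀ᵐ t ∂(volume.restrict (Icc a b)), t ∈ Icc u v → deriv f t ≤ L) :
    f v - f u ≤ L * (v - u) := by
  have hsub : uIcc u v ⊆ uIcc a b := by
    rw [uIcc_of_le huv, uIcc_of_le (hau.trans (huv.trans hvb))]
    exact Icc_subset_Icc hau hvb
  have hf' : AbsolutelyContinuousOnInterval f u v := hf.mono hsub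
  have hftc : ∫ x in u..v, deriv f x = f v - f u := hf'.integral_deriv_eq_sub
  have hint : IntervalIntegrable (deriv f) volume u v := hf'.intervalIntegrable_deriv
  have hle : ∫ x in u..v, deriv f x ≤ ∫ _ in u..v, L := by
    refine intervalIntegral.integral_mono_ae_restrict huv hint intervalIntegrable_const ?_
    have h1 : ∀ᵐ t ∂(volume.restrict (Icc u v)), t ∈ Icc u v → deriv f t ≤ L :=
      ae_restrict_of_ae_restrict_of_subset (Icc_subset_Icc hau hvb) h
    filter_upwards [h1, ae_restrict_mem measurableSet_Icc] with t h1 h2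
    exact h1 h2
  rw [hftc, intervalIntegral.integral_const, smul_eq_mul] at hle
  linarith

/-! ## One level of descent -/

/-- One step of the printed iteration (Cor. 25, proof): if `f(u) ≤ (m+1)·D`, and almost everywhere
`deriv f ≤ (1 − ρ·4^m)·D` at points where `f ≥ m·D`, with `ρ·4^m ≥ 2`, then within time
`2/(ρ·4^m)` the function `f` drops to level `m·D`: «it is not possible … to have `H̃_T(t') ≥ δ m T log³ T`
for all `t ≤ t' ≤ t + c⁻¹2^{−2m}`, as this would violate the fundamental theorem of calculus».
[cite: RodgersTaoFMP2020, Cor. 25 p. 56 (proof)] -/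
theorem descent_step {f : ℝ → ℝ} {a b D ρ : ℝ} (hf : AbsolutelyContinuousOnInterval f a b)
    (hD : 0 < D) (hρ : 0 < ρ)
    (hdown : ∀ᵐ t ∂(volume.restrict (Icc a b)), ∀ m : ℕ, 1 ≤ m → (m : ℝ) * D ≤ f t →
      deriv f t ≤ (1 - ρ * 4 ^ m) * D)
    {m : ℕ} (hm : 1 ≤ m) (hρm : 2 ≤ ρ * 4 ^ m)
    {u : ℝ} (hau : a ≤ u) (hub : u + 2 / (ρ * 4 ^ m) ≤ b) (hfu : f u ≤ ((m : ℝ) + 1) * D) :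
    ∃ s ∈ Icc u (u + 2 / (ρ * 4 ^ m)), f s ≤ (m : ℝ) * D := by
  by_contra! hcon
  have hpow : 0 < ρ * 4 ^ m := by positivity
  have hτpos : 0 < 2 / (ρ * 4 ^ m) := by positivity
  have hτle : 2 / (ρ * 4 ^ m) ≤ 1 := by
    rw [div_le_one hpow]
    exact hρm
  have hv := hcon (u + 2 / (ρ * 4 ^ m)) ⟨by linarith, le_rfl⟩
  have hslope : f (u + 2 / (ρ * 4 ^ m)) - f u ≤
      (1 - ρ * 4 ^ m) * D * (u + 2 / (ρ * 4 ^ m) - u) := by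
    refine sub_le_mul_of_ae_deriv_le hf hau (by linarith) hub ?_
    filter_upwards [hdown] with t ht hmem
    exact ht m hm (hcon t hmem).le
  have hkey : (1 - ρ * 4 ^ m) * D * (u + 2 / (ρ * 4 ^ m) - u) =
      D * (2 / (ρ * 4 ^ m)) - 2 * D := by
    field_simp
    ring
  have hDτ : D * (2 / (ρ * 4 ^ m)) ≤ D := mul_le_of_le_one_right hD.le hτle
  rw [hkey] at hslope
  linarith

/-! ## The iteration: geometric time budget -/

/-- The printed iteration of Cor. 25 as an ABSTRACT LEMMA. Let `ρ > 0` and `a < e ≤ b`. There is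
`K ≥ 0` (depending only on `ρ, a, b, e`) such that for every `f` absolutely continuous on `[a, b]`
and every `D > 0` with, almost everywhere on `[a, b]`, `deriv f ≤ D` and
(`∀ m ≥ 1`, `m·D ≤ f(t) → deriv f(t) ≤ (1 − ρ·4^m)·D`), one has `f ≤ K·D` on `[e, b]`: levels are
descended one at a time, each level `m ≥ m₁` costing time at most `2/(ρ·4^m)`, the total
`Σ_{m ≥ m₁} 2/(ρ·4^m) = 8/(3ρ·4^{m₁}) ≤ e − a` («on iterating this … there exists
`Λ/2 ≤ t'' ≤ Λ/4` obeying (ham)»), after which `deriv f ≤ D` a.e. and the fundamental theorem of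
calculus bound `f` on `[t'', b] ⊇ [e, b]` («absorbing `m₀` into the implied constants»).
[cite: RodgersTaoFMP2020, Cor. 25 p. 56 (proof)] -/
theorem descent_bound {ρ a b e : ℝ} (hρ : 0 < ρ) (hae : a < e) (heb : e ≤ b) :
    ∃ K : ℝ, 0 ≤ K ∧ ∀ (f : ℝ → ℝ) (D : ℝ), 0 < D → AbsolutelyContinuousOnInterval f a b →
      (∀ᵐ t ∂(volume.restrict (Icc a b)), deriv f t ≤ D) →
      (∀ᵐ t ∂(volume.restrict (Icc a b)), ∀ m : ℕ, 1 ≤ m → (m : ℝ) * D ≤ f t →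
        deriv f t ≤ (1 - ρ * 4 ^ m) * D) →
      ∀ t ∈ Icc e b, f t ≤ K * D := by
  -- choice of the level `m₁` («`m₀` large enough»)
  obtain ⟨n, hn⟩ := pow_unbounded_of_one_lt (max (2 / ρ) (8 / (3 * ρ * (e - a))))
    (by norm_num : (1 : ℝ) < 4)
  set m₁ : ℕ := n + 1 with hm₁_def
  have hea : 0 < e - a := sub_pos.2 hae
  have h4n : (4 : ℝ) ^ n ≤ 4 ^ m₁ := pow_le_pow_right₀ (by norm_num) (Nat.le_succ n)
  have hm₁ : 1 ≤ m₁ := Nat.succ_le_succ (Nat.zero_le n)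
  have hρm₁ : 2 ≤ ρ * 4 ^ m₁ := by
    have h1 : 2 / ρ < 4 ^ m₁ := lt_of_le_of_lt (le_max_left _ _) (hn.trans_le h4n)
    rw [div_lt_iff₀ hρ] at h1
    linarith
  -- the time budget `σ m = Σ_{i ≥ m} 2/(ρ 4^i) = 8/(3 ρ 4^m)`
  have hσm₁ : 8 / (3 * ρ * 4 ^ m₁) ≤ e - a := by
    have h1 : 8 / (3 * ρ * (e - a)) < 4 ^ m₁ :=
      lt_of_le_of_lt (le_max_right _ _) (hn.trans_le h4n)
    rw [div_lt_iff₀ (by positivity)] at h1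
    rw [div_le_iff₀ (by positivity)]
    linarith
  have hσ_anti : ∀ {m m' : ℕ}, m ≤ m' → 8 / (3 * ρ * 4 ^ m') ≤ 8 / (3 * ρ * 4 ^ m) := by
    intro m m' hmm'
    have : (4 : ℝ) ^ m ≤ 4 ^ m' := pow_le_pow_right₀ (by norm_num) hmm'
    gcongr
  have hσ_step : ∀ m : ℕ, 8 / (3 * ρ * 4 ^ (m + 1)) + 2 / (ρ * 4 ^ m) = 8 / (3 * ρ * 4 ^ m) := by
    intro m
    rw [pow_succ]
    field_simp
    ring
  have hρ_mono : ∀ {m : ℕ}, m₁ ≤ m → 2 ≤ ρ * 4 ^ m := by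
    intro m hm
    have : (4 : ℝ) ^ m₁ ≤ 4 ^ m := pow_le_pow_right₀ (by norm_num) hm
    nlinarith
  refine ⟨(m₁ : ℝ) + 1 + (b - a), add_nonneg (by positivity) (sub_nonneg.2 (hae.le.trans heb)), ?_⟩
  intro f D hD hf hup hdown
  -- the starting level `M`: `f a ≤ (M + 1) D`
  set M : ℕ := ⌈f a / D⌉₊ with hM_def
  have hfa : f a ≤ ((M : ℝ) + 1) * D := by
    have h1 : f a / D ≤ M := Nat.le_ceil _
    rw [div_le_iff₀ hD] at h1
    linarith
  -- the descent, by induction on the number `k` of levels crossed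
  have hiter : ∀ k ℓ : ℕ, ℓ + k = M → m₁ ≤ ℓ →
      ∃ s ∈ Icc a b, s - a ≤ 8 / (3 * ρ * 4 ^ (ℓ + 1)) ∧ f s ≤ ((ℓ : ℝ) + 1) * D := by
    intro k
    induction k with
    | zero =>
      intro ℓ hℓ _
      rw [add_zero] at hℓ
      subst hℓ
      exact ⟨a, ⟨le_rfl, (hae.le.trans heb)⟩, by simp only [sub_self]; positivity, hfa⟩
    | succ k ih =>
      intro ℓ hℓ hℓm
      obtain ⟨s, hs, hsa, hfs⟩ := ih (ℓ + 1) (by omega) (by omega)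
      have hℓ1 : 1 ≤ ℓ + 1 := by omega
      have hρℓ : 2 ≤ ρ * 4 ^ (ℓ + 1) := hρ_mono (by omega)
      have hroom : s + 2 / (ρ * 4 ^ (ℓ + 1)) ≤ e := by
        have h1 := hσ_step (ℓ + 1)
        have h2 : 8 / (3 * ρ * 4 ^ (ℓ + 1)) ≤ 8 / (3 * ρ * 4 ^ m₁) := hσ_anti (by omega)
        linarith
      have hfs' : f s ≤ (((ℓ + 1 : ℕ) : ℝ) + 1) * D := by
        push_cast at hfs ⊢
        linarith
      obtain ⟨s', hs', hfs''⟩ :=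
        descent_step hf hD hρ hdown hℓ1 hρℓ hs.1 (hroom.trans heb) hfs'
      refine ⟨s', ⟨hs.1.trans hs'.1, (hs'.2.trans hroom).trans heb⟩, ?_, ?_⟩
      · have h1 := hσ_step (ℓ + 1)
        linarith [hs'.2]
      · push_cast at hfs''
        exact hfs''
  -- a time `s ≤ e` with `f s ≤ (m₁ + 1) D`
  have hlow : ∃ s ∈ Icc a e, f s ≤ ((m₁ : ℝ) + 1) * D := by
    rcases le_or_gt m₁ M with hle | hlt
    · obtain ⟨s, hs, hsa, hfs⟩ := hiter (M - m₁) m₁ (by omega) le_rfl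
      have h2 : 8 / (3 * ρ * 4 ^ (m₁ + 1)) ≤ 8 / (3 * ρ * 4 ^ m₁) := hσ_anti (by omega)
      exact ⟨s, ⟨hs.1, by linarith⟩, hfs⟩
    · refine ⟨a, ⟨le_rfl, hae.le⟩, hfa.trans ?_⟩
      have : (M : ℝ) + 1 ≤ (m₁ : ℝ) + 1 := by exact_mod_cast Nat.succ_le_succ hlt.le
      exact mul_le_mul_of_nonneg_right this hD.le
  obtain ⟨s, hs, hfs⟩ := hlow
  intro t ht
  have hst : s ≤ t := hs.2.trans ht.1
  have hslope : f t - f s ≤ D * (t - s) := by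
    refine sub_le_mul_of_ae_deriv_le hf hs.1 hst ht.2 ?_
    filter_upwards [hup] with x hx _ using hx
  have h1 : D * (t - s) ≤ D * (b - a) := by
    apply mul_le_mul_of_nonneg_left _ hD.le
    linarith [hs.1, ht.2]
  nlinarith

/-! ## «δ → 0 sufficiently slowly»: an explicit threshold rate -/

/-- The printed «if `δ = δ(T)` goes to zero sufficiently slowly» made explicit: from an input of the
shape `∀ ε > 0, ∃ T₁, ∀ T ≥ T₁, P ε T` one extracts a positive rate `δ₁(T) ≤ 1`, `δ₁(T) → 0`, with
`P (δ₁ T) T` for all large `T`; any `δ ≥ δ₁` then enjoys the `ε := δ₁(T) ≤ δ(T)` instance at time `T`.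
[cite: RodgersTaoFMP2020, Cor. 25 p. 56 (proof); Lemma 24 p. 54 (statement)] -/
theorem exists_rate {P : ℝ → ℝ → Prop}
    (hP : ∀ ε : ℝ, 0 < ε → ∃ T₁ : ℝ, ∀ T : ℝ, T₁ ≤ T → P ε T) :
    ∃ δ₁ : ℝ → ℝ, (∀ T, 0 < δ₁ T) ∧ (∀ T, δ₁ T ≤ 1) ∧ Tendsto δ₁ atTop (𝓝 0) ∧
      ∃ T₀ : ℝ, ∀ T : ℝ, T₀ ≤ T → P (δ₁ T) T := by
  classical
  choose S hS using fun n : ℕ ↦ hP (1 / ((n : ℝ) + 1)) (by positivity)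
  -- `N T` := the largest `n ≤ ⌈T⌉₊` with `n ≤ T` and `S n ≤ T`
  let N : ℝ → ℕ := fun T ↦ Nat.findGreatest (fun n : ℕ ↦ (n : ℝ) ≤ T ∧ S n ≤ T) ⌈T⌉₊
  refine ⟨fun T ↦ 1 / ((N T : ℝ) + 1), fun T ↦ by positivity, fun T ↦ ?_, ?_, max 0 (S 0),
    fun T hT ↦ ?_⟩
  · rw [div_le_one (by positivity)]
    linarith [(N T).cast_nonneg (α := ℝ)]
  · rw [Metric.tendsto_atTop]
    intro ε hε
    obtain ⟨n, hn⟩ := exists_nat_one_div_lt hε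
    refine ⟨max (n : ℝ) (S n), fun T hT ↦ ?_⟩
    have hQ : (n : ℝ) ≤ T ∧ S n ≤ T := ⟨(le_max_left _ _).trans hT, (le_max_right _ _).trans hT⟩
    have hnT : n ≤ ⌈T⌉₊ := by
      have : (n : ℝ) ≤ (⌈T⌉₊ : ℝ) := hQ.1.trans (Nat.le_ceil T)
      exact_mod_cast this
    have hnN : n ≤ N T := Nat.le_findGreatest hnT hQ
    rw [Real.dist_0_eq_abs, abs_of_pos (by positivity)]
    calc 1 / ((N T : ℝ) + 1) ≤ 1 / ((n : ℝ) + 1) := by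
          apply one_div_le_one_div_of_le (by positivity)
          exact_mod_cast Nat.succ_le_succ hnN
      _ < ε := hn
  · have hQ0 : ((0 : ℕ) : ℝ) ≤ T ∧ S 0 ≤ T :=
      ⟨by simpa using (le_max_left _ _).trans hT, (le_max_right _ _).trans hT⟩
    have hspec : ((N T : ℕ) : ℝ) ≤ T ∧ S (N T) ≤ T :=
      Nat.findGreatest_spec (P := fun n : ℕ ↦ (n : ℝ) ≤ T ∧ S n ≤ T) (Nat.zero_le _) hQ0
    exact hS (N T) T hspec.2

end RodgersTaoTruncHamiltonianBound

/-! ## The schema and the as-printed reduction -/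

open RodgersTaoTruncHamiltonianBound in
/-- **Rodgers–Tao 2020, Corollary 25 — RH-free SCHEMA at a fixed time `t₀ < 0` with `H_{t₀}`
real-rooted.** The inner shapes (as typed in `RodgersTaoHamiltonian`) of Lemma 19
(`H̃_T(t) = Σ_{j∼_T k} ψψ H̃_{jk}(t) + o(T log³ T)`, uniformly in `t₀/2 ≤ t ≤ 0`), Proposition 22
(`H̃_T` absolutely continuous on `[t₀/2, 0]` with `∂ₜH̃_T = −4Ẽ_T + o(T log³ T + Ẽ_T)` a.e.) and
Lemma 24 (`H̃_T(t) ≥ δ m T log³ T ⟹ Ẽ_T(t) ≥ c δ 2^{2m} T log³ T` for `δ → 0` slower than a threshold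
rate) imply the inner shape of Corollary 25: there are a threshold rate `δ₁ > 0`, `δ₁(T) → 0`, and
`C` such that for every positive `δ(T) → 0` with `δ₁ ≤ δ` eventually,
`|H̃_T(t)| ≤ C δ(T) T log³ T` for all large `T` and all `t₀/4 ≤ t ≤ 0` («One has
`H̃_T(t) = O(δ T log³₊ T)` for `Λ/4 ≤ t ≤ 0`»). Proof as printed (p. 56), through
`descent_bound` (upper bound) and Lemma 19 with `H̃_{jk} ≥ 0` (lower bound, «recalling that `H̃_T`
is non-negative»).
[cite: RodgersTaoFMP2020, Cor. 25 p. 56 (= arXiv:1801.05914v4 Cor. 7.10)] -/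
theorem rodgers_tao_truncHamiltonian_bound_of {t₀ : ℝ} (ht₀ : t₀ < 0)
    (hreal : HasOnlyRealZeros (deBruijnH t₀))
    (h19 : ∀ ε : ℝ, 0 < ε → ∃ T₁ : ℝ, ∀ T : ℝ, T₁ ≤ T → ∀ t : ℝ, t₀ / 2 ≤ t → t ≤ 0 →
      Summable (truncHamiltonianTerm T t) ∧
      Summable (fun p : nearbyPairs T ↦
        truncWeight T p.1.1 * truncWeight T p.1.2 * renormHamiltonianZ t p.1.1 p.1.2) ∧
      |truncHamiltonian T t - ∑' p : nearbyPairs T,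
          truncWeight T p.1.1 * truncWeight T p.1.2 * renormHamiltonianZ t p.1.1 p.1.2|
        ≤ ε * (T * Real.log T ^ 3))
    (h22 : ∀ ε : ℝ, 0 < ε → ∃ T₁ : ℝ, ∀ T : ℝ, T₁ ≤ T →
      AbsolutelyContinuousOnInterval (truncHamiltonian T) (t₀ / 2) 0 ∧
      ∀ᵐ t ∂(volume.restrict (Icc (t₀ / 2) 0)),
        Summable (truncEnergyTerm T t) ∧
        |deriv (truncHamiltonian T) t + 4 * truncEnergy T t| ≤
          ε * (T * Real.log T ^ 3 + truncEnergy T t))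
    (h24 : ∃ δ₀ : ℝ → ℝ, (∀ T, 0 < δ₀ T) ∧ Tendsto δ₀ atTop (𝓝 0) ∧
      ∃ c : ℝ, 0 < c ∧
      ∀ δ : ℝ → ℝ, (∀ T, 0 < δ T) → Tendsto δ atTop (𝓝 0) → (∀ᶠ T in atTop, δ₀ T ≤ δ T) →
        ∃ T₁ : ℝ, ∀ T : ℝ, T₁ ≤ T → ∀ t : ℝ, t₀ / 2 ≤ t → t ≤ 0 → ∀ m : ℕ, 1 ≤ m →
          δ T * m * (T * Real.log T ^ 3) ≤ truncHamiltonian T t →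
          Summable (truncEnergyTerm T t) →
            c * (δ T * 2 ^ (2 * m) * (T * Real.log T ^ 3)) ≤ truncEnergy T t) :
    ∃ δ₁ : ℝ → ℝ, (∀ T, 0 < δ₁ T) ∧ Tendsto δ₁ atTop (𝓝 0) ∧
    ∃ C : ℝ,
      ∀ δ : ℝ → ℝ, (∀ T, 0 < δ T) → Tendsto δ atTop (𝓝 0) → (∀ᶠ T in atTop, δ₁ T ≤ δ T) →
        ∃ T₁ : ℝ, ∀ T : ℝ, T₁ ≤ T → ∀ t : ℝ, t₀ / 4 ≤ t → t ≤ 0 →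
          |truncHamiltonian T t| ≤ C * (δ T * (T * Real.log T ^ 3)) := by
  obtain ⟨δ₀, hδ₀pos, hδ₀lim, c, hc, H24⟩ := h24
  -- the rate extracted from Lemma 19 and Proposition 22 together
  have hP : ∀ ε : ℝ, 0 < ε → ∃ T₁ : ℝ, ∀ T : ℝ, T₁ ≤ T →
      (∀ t : ℝ, t₀ / 2 ≤ t → t ≤ 0 →
        Summable (truncHamiltonianTerm T t) ∧
        Summable (fun p : nearbyPairs T ↦
          truncWeight T p.1.1 * truncWeight T p.1.2 * renormHamiltonianZ t p.1.1 p.1.2) ∧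
        |truncHamiltonian T t - ∑' p : nearbyPairs T,
            truncWeight T p.1.1 * truncWeight T p.1.2 * renormHamiltonianZ t p.1.1 p.1.2|
          ≤ ε * (T * Real.log T ^ 3)) ∧
      (AbsolutelyContinuousOnInterval (truncHamiltonian T) (t₀ / 2) 0 ∧
        ∀ᵐ t ∂(volume.restrict (Icc (t₀ / 2) 0)),
          Summable (truncEnergyTerm T t) ∧
          |deriv (truncHamiltonian T) t + 4 * truncEnergy T t| ≤
            ε * (T * Real.log T ^ 3 + truncEnergy T t)) := by
    intro ε hε
    obtain ⟨T₁, hT₁⟩ := h19 ε hε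
    obtain ⟨T₂, hT₂⟩ := h22 ε hε
    exact ⟨max T₁ T₂, fun T hT ↦ ⟨hT₁ T ((le_max_left _ _).trans hT),
      hT₂ T ((le_max_right _ _).trans hT)⟩⟩
  obtain ⟨δ₂, hδ₂pos, hδ₂le, hδ₂lim, T₀, HP⟩ := exists_rate hP
  -- the constant of the descent lemma, with `ρ := 3c`, `[a, b] := [t₀/2, 0]`, `e := t₀/4`
  obtain ⟨K, hK0, hK⟩ := descent_bound (ρ := 3 * c) (a := t₀ / 2) (b := 0) (e := t₀ / 4)
    (by positivity) (by linarith) (by linarith)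
  refine ⟨fun T ↦ max (δ₀ T) (δ₂ T), fun T ↦ lt_max_of_lt_left (hδ₀pos T), ?_, max K 1, ?_⟩
  · simpa only [max_self] using hδ₀lim.max hδ₂lim
  intro δ hδpos hδlim hev
  have hev₀ : ∀ᶠ T in atTop, δ₀ T ≤ δ T :=
    hev.mono fun T hT ↦ (le_max_left _ _).trans hT
  obtain ⟨T₁, HT₁⟩ := H24 δ hδpos hδlim hev₀
  obtain ⟨T₂, HT₂⟩ := Filter.eventually_atTop.1 hev
  refine ⟨max (max T₁ T₂) (max T₀ 3), fun T hT t ht₁ ht₂ ↦ ?_⟩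
  have hTT₁ : T₁ ≤ T := le_trans (le_trans (le_max_left _ _) (le_max_left _ _)) hT
  have hTT₂ : T₂ ≤ T := le_trans (le_trans (le_max_right _ _) (le_max_left _ _)) hT
  have hTT₀ : T₀ ≤ T := le_trans (le_trans (le_max_left _ _) (le_max_right _ _)) hT
  have hT3 : 3 ≤ T := le_trans (le_trans (le_max_right _ _) (le_max_right _ _)) hT
  have hlog : 0 < Real.log T := Real.log_pos (by linarith)
  have hT0 : 0 < T := by linarith
  have hTlog : 0 < T * Real.log T := mul_pos hT0 hlog
  have hTL : 0 < T * Real.log T ^ 3 := by positivity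
  -- `ε := δ₂ T ≤ δ T`, `D := δ(T) · T log³ T`
  have hεδ : δ₂ T ≤ δ T := (le_max_right _ _).trans (HT₂ T hTT₂)
  have hε1 : δ₂ T ≤ 1 := hδ₂le T
  have hεpos : 0 < δ₂ T := hδ₂pos T
  have hD : 0 < δ T * (T * Real.log T ^ 3) := mul_pos (hδpos T) hTL
  obtain ⟨H19, hAC, H22⟩ := HP T hTT₀
  -- zeros are strictly increasing at every `t ∈ [t₀/2, 0]`
  have hmono : ∀ s : ℝ, t₀ / 2 ≤ s → StrictMono (deBruijnZeroZ s) := fun s hs ↦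
    strictMono_deBruijnZeroZ ⟨t₀, by linarith, hreal⟩
  -- a.e. upper bound on the derivative: `∂ₜ H̃_T ≤ D`
  have hup : ∀ᵐ s ∂(volume.restrict (Icc (t₀ / 2) 0)),
      deriv (truncHamiltonian T) s ≤ δ T * (T * Real.log T ^ 3) := by
    filter_upwards [H22, ae_restrict_mem measurableSet_Icc] with s hs hmem
    have hE : 0 ≤ truncEnergy T s := truncEnergy_nonneg hTlog (hmono s hmem.1)
    have h1 := (abs_le.1 hs.2).2
    have h2 : δ₂ T * (T * Real.log T ^ 3) ≤ δ T * (T * Real.log T ^ 3) :=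
      mul_le_mul_of_nonneg_right hεδ hTL.le
    have h3 : δ₂ T * truncEnergy T s ≤ 1 * truncEnergy T s :=
      mul_le_mul_of_nonneg_right hε1 hE
    nlinarith
  -- a.e. descent rate above level `m`: Lemma 24 + Proposition 22
  have hdown : ∀ᵐ s ∂(volume.restrict (Icc (t₀ / 2) 0)), ∀ m : ℕ, 1 ≤ m →
      (m : ℝ) * (δ T * (T * Real.log T ^ 3)) ≤ truncHamiltonian T s →
      deriv (truncHamiltonian T) s ≤ (1 - 3 * c * 4 ^ m) * (δ T * (T * Real.log T ^ 3)) := by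
    filter_upwards [H22, ae_restrict_mem measurableSet_Icc] with s hs hmem
    intro m hm hle
    have hE : 0 ≤ truncEnergy T s := truncEnergy_nonneg hTlog (hmono s hmem.1)
    have hle' : δ T * m * (T * Real.log T ^ 3) ≤ truncHamiltonian T s := by
      have : δ T * m * (T * Real.log T ^ 3) = (m : ℝ) * (δ T * (T * Real.log T ^ 3)) := by ring
      rw [this]
      exact hle
    have h24 := HT₁ T hTT₁ s hmem.1 hmem.2 m hm hle' hs.1
    have h4 : c * (δ T * 2 ^ (2 * m) * (T * Real.log T ^ 3)) =
        c * 4 ^ m * (δ T * (T * Real.log T ^ 3)) := by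
      rw [pow_mul]
      norm_num
      ring
    rw [h4] at h24
    have h1 := (abs_le.1 hs.2).2
    have h2 : δ₂ T * (T * Real.log T ^ 3) ≤ δ T * (T * Real.log T ^ 3) :=
      mul_le_mul_of_nonneg_right hεδ hTL.le
    have h3 : δ₂ T * truncEnergy T s ≤ 1 * truncEnergy T s :=
      mul_le_mul_of_nonneg_right hε1 hE
    nlinarith
  -- the upper bound from the descent lemma
  have hupper : truncHamiltonian T t ≤ K * (δ T * (T * Real.log T ^ 3)) :=
    hK (truncHamiltonian T) _ hD hAC hup hdown t ⟨ht₁, ht₂⟩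
  -- the lower bound from Lemma 19 and `H̃_{jk} ≥ 0`
  have ht' : t₀ / 2 ≤ t := by linarith
  obtain ⟨-, -, h19t⟩ := H19 t ht' ht₂
  have hS : 0 ≤ ∑' p : nearbyPairs T,
      truncWeight T p.1.1 * truncWeight T p.1.2 * renormHamiltonianZ t p.1.1 p.1.2 := by
    refine tsum_nonneg fun p ↦ mul_nonneg (mul_nonneg (truncWeight_pos hTlog _).le
      (truncWeight_pos hTlog _).le) ?_
    exact renormHamiltonianZ_nonneg_of_strictMono (hmono t ht')
      ((nearbyPairs_subset_zstarOffDiag T) p.2).2.2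
  have hlower : -(δ T * (T * Real.log T ^ 3)) ≤ truncHamiltonian T t := by
    have h1 := (abs_le.1 h19t).1
    have h2 : δ₂ T * (T * Real.log T ^ 3) ≤ δ T * (T * Real.log T ^ 3) :=
      mul_le_mul_of_nonneg_right hεδ hTL.le
    linarith
  have hK1 : K ≤ max K 1 := le_max_left _ _
  have h11 : (1 : ℝ) ≤ max K 1 := le_max_right _ _
  rw [abs_le]
  constructor
  · nlinarith
  · nlinarith

/-- **Rodgers–Tao 2020, Corollary 25 — AS-PRINTED reduction (RH-free, no use of `Λ ≥ 0`).**
Lemma 19, Proposition 22 and Lemma 24, in their tree shapes `rodgers_tao_truncHamiltonian_expansion`,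
`rodgers_tao_truncHamiltonian_deriv`, `rodgers_tao_truncEnergy_lower_bound`, imply Corollary 25 in
its tree shape `rodgers_tao_truncHamiltonian_bound` («From Proposition 22 and Lemma 24 …»; Lemma 19
for «recalling that `H̃_T` is non-negative»).
[cite: RodgersTaoFMP2020, Cor. 25 p. 56 (= arXiv:1801.05914v4 Cor. 7.10)] -/
theorem rodgers_tao_truncHamiltonian_bound_of_facts
    (h19 : rodgers_tao_truncHamiltonian_expansion) (h22 : rodgers_tao_truncHamiltonian_deriv)
    (h24 : rodgers_tao_truncEnergy_lower_bound) : rodgers_tao_truncHamiltonian_bound :=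
  fun t₀ ht₀ hreal ↦
    rodgers_tao_truncHamiltonian_bound_of ht₀ hreal (h19 t₀ ht₀ hreal) (h22 t₀ ht₀ hreal)
      (h24 t₀ ht₀ hreal)

end Literature.NumberTheory.LFunctions

end
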